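import Literature.Computability.MetaComplexity.EFModAdd
import HarnessLib

/-!
# Modular addition in extended Frege: domain closure (`x, y < n ⟹ x ⊕ₙ y < n`)

Layer D/2 of the `EF`-proof construction kit: the law that the modular sum of two words below
`n` is again below `n` — inside Frege, as a polynomial-size derivation of the negated domain
wire of an occurrence of `ModAdd.addModT` from the certificates `LtN` of its operands. The laws
of modular arithmetic are conditional on such certificates, and this law propagates them along
chains of operations.

The argument (for `s = x + y`, `G = [s ≥ n]`, `d = s - n`, `u = G ? d : s`):
* if `¬G` then `s < n`, the top bit of `s` vanishes and `u = s < n` (`Sub.isBlock_topBit`);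
* if `G` then `d + n = s = y + x < n + x` (monotonicity from `y < n`), `d + n` does not overflow,
  hence `d < x` (monotonicity reversed) and `d < n` by transitivity with `x < n`; the top bit of
  `d` vanishes and `u = d < n`.
The auxiliary circuits (adders `y + x`, `n + x`, `d + n`, `x + n` and five comparators) form the
template `ModAdd.domAuxT W` (a `Netlist.layout` of ten pieces reading `x, y, n` and the
difference wires `d` of the occurrence); the law `ModAdd.domOp` assumes an available occurrence
of it.

## Sources

* S. A. Cook, R. A. Reckhow, *The relative efficiency of propositional proof systems*,
  J. Symbolic Logic 44 (1979), §2 (sound schematic rules).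
* J. Krajíček, *Bounded Arithmetic, Propositional Logic, and Complexity Theory* (CUP 1995), §9.2
  (laws of binary arithmetic in `EF`; here constructed directly).
-/

namespace Literature.Computability.MetaComplexity

open _root_.Computability Complexity Complexity.PropForm FregeSystem Netlist

namespace ModAdd

/-! ### The auxiliary template

Inputs (`4W + 1`): `x` (`0…W-1`), `y` (`W…2W-1`), `n` (`2W…3W-1`) and the difference bits
`d₀…d_W` (`3W…4W`) of the occurrence. -/

namespace DomAux

/-- Wiring of `y + x`. [folklore] -/
def wYX (W i : ℕ) : ℕ ⊕ ℕ := if i < W then Sum.inl (W + i) else Sum.inl (i - W)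

/-- Wiring of `n + x`. [folklore] -/
def wNX (W i : ℕ) : ℕ ⊕ ℕ := if i < W then Sum.inl (2 * W + i) else Sum.inl (i - W)

/-- Wiring of the comparator of `y + x` with `n + x` (`W+1` bits). [folklore] -/
def wT1 (W i : ℕ) : ℕ ⊕ ℕ :=
  if i < W then Sum.inr (1 + (2 * i + 1)) else if i = W then Sum.inr (1 + 2 * W)
  else if i < 2 * W + 1 then Sum.inr (2 * W + 2 + (2 * (i - (W + 1)) + 1)) else Sum.inr (2 * W + 2 + 2 * W)

/-- Wiring of `d + n` (`W+1` bits, `n` zero-extended by the `⊥` gate `0`). [folklore] -/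
def wE (W i : ℕ) : ℕ ⊕ ℕ :=
  if i < W + 1 then Sum.inl (3 * W + i) else if i < 2 * W + 1 then Sum.inl (2 * W + (i - (W + 1))) else Sum.inr 0

/-- Wiring of `x + n` on zero-extended operands (`W+1` bits). [folklore] -/
def wXN (W i : ℕ) : ℕ ⊕ ℕ :=
  if i < W then Sum.inl i else if i = W then Sum.inr 0
  else if i < 2 * W + 1 then Sum.inl (2 * W + (i - (W + 1))) else Sum.inr 0

/-- Wiring of the comparator of `d + n` with `x + n` (`W+2` bits). [folklore] -/
def wT2 (W i : ℕ) : ℕ ⊕ ℕ :=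
  if i < W + 1 then Sum.inr (7 * W + 7 + (2 * i + 1)) else if i = W + 1 then Sum.inr (7 * W + 7 + 2 * (W + 1))
  else if i < 2 * W + 3 then Sum.inr (9 * W + 10 + (2 * (i - (W + 2)) + 1)) else Sum.inr (9 * W + 10 + 2 * (W + 1))

/-- Wiring of the comparator of `d` with `x` (`W+1` bits). [folklore] -/
def wCDX (W i : ℕ) : ℕ ⊕ ℕ :=
  if i < W + 1 then Sum.inl (3 * W + i) else if i < 2 * W + 1 then Sum.inl (i - (W + 1)) else Sum.inr 0

/-- Wiring of the comparator of `x` with `n` on zero-extended operands (`W+1` bits). [folklore] -/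
def wCXN (W i : ℕ) : ℕ ⊕ ℕ :=
  if i < W then Sum.inl i else if i = W then Sum.inr 0
  else if i < 2 * W + 1 then Sum.inl (2 * W + (i - (W + 1))) else Sum.inr 0

/-- Wiring of the comparator of `d` with `n` (`W+1` bits). [folklore] -/
def wCD (W i : ℕ) : ℕ ⊕ ℕ :=
  if i < W + 1 then Sum.inl (3 * W + i) else if i < 2 * W + 1 then Sum.inl (2 * W + (i - (W + 1))) else Sum.inr 0

/-- The ten pieces: the `⊥` gate, `y + x`, `n + x`, their comparator, `d + n`, `x + n`, their
comparator, and the comparators of `d` with `x`, of `x` with `n`, of `d` with `n`.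
[cite: Vollmer1999, §1.2] -/
def pieces (W : ℕ) : ℕ → Piece
  | 0 => ⟨[⟨Kind.cst false, []⟩], 0, Sum.inl⟩
  | 1 => ⟨Adder.addT false W, 2 * W, wYX W⟩
  | 2 => ⟨Adder.addT false W, 2 * W, wNX W⟩
  | 3 => ⟨Sub.subT (W + 1), 2 * (W + 1), wT1 W⟩
  | 4 => ⟨Adder.addT false (W + 1), 2 * (W + 1), wE W⟩
  | 5 => ⟨Adder.addT false (W + 1), 2 * (W + 1), wXN W⟩
  | 6 => ⟨Sub.subT (W + 2), 2 * (W + 2), wT2 W⟩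
  | 7 => ⟨Sub.subT (W + 1), 2 * (W + 1), wCDX W⟩
  | 8 => ⟨Sub.subT (W + 1), 2 * (W + 1), wCXN W⟩
  | _ => ⟨Sub.subT (W + 1), 2 * (W + 1), wCD W⟩

end DomAux

/-- **The auxiliary template of domain closure.** [cite: Vollmer1999, §1.2] -/
def domAuxT (W : ℕ) : Template := layout (DomAux.pieces W) 10

namespace DomAux

/-- The offsets of the ten pieces. [folklore] -/
theorem offsets (W : ℕ) :
    offset (pieces W) 1 = 1 ∧ offset (pieces W) 2 = 2 * W + 2 ∧ offset (pieces W) 3 = 4 * W + 3 ∧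
    offset (pieces W) 4 = 7 * W + 7 ∧ offset (pieces W) 5 = 9 * W + 10 ∧ offset (pieces W) 6 = 11 * W + 13 ∧
    offset (pieces W) 7 = 14 * W + 20 ∧ offset (pieces W) 8 = 17 * W + 24 ∧ offset (pieces W) 9 = 20 * W + 28 ∧
    offset (pieces W) 10 = 23 * W + 32 := by
  have h1 : offset (pieces W) 1 = 1 := by rw [offset_succ, offset_zero]; simp [pieces]
  have h2 : offset (pieces W) 2 = 2 * W + 2 := by rw [offset_succ, h1]; simp [pieces]; ring
  have h3 : offset (pieces W) 3 = 4 * W + 3 := by rw [offset_succ, h2]; simp [pieces]; ring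
  have h4 : offset (pieces W) 4 = 7 * W + 7 := by rw [offset_succ, h3]; simp [pieces]; ring
  have h5 : offset (pieces W) 5 = 9 * W + 10 := by rw [offset_succ, h4]; simp [pieces]; ring
  have h6 : offset (pieces W) 6 = 11 * W + 13 := by rw [offset_succ, h5]; simp [pieces]; ring
  have h7 : offset (pieces W) 7 = 14 * W + 20 := by rw [offset_succ, h6]; simp [pieces]; ring
  have h8 : offset (pieces W) 8 = 17 * W + 24 := by rw [offset_succ, h7]; simp [pieces]; ring
  have h9 : offset (pieces W) 9 = 20 * W + 28 := by rw [offset_succ, h8]; simp [pieces]; ring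
  have h10 : offset (pieces W) 10 = 23 * W + 32 := by rw [offset_succ, h9]; simp [pieces]; ring
  exact ⟨h1, h2, h3, h4, h5, h6, h7, h8, h9, h10⟩

/-- A piece wired to an adder/comparator of two words given by input maps is well wired as soon as
each wiring value is an input `< 4W+1` or a gate below the offset. [folklore] -/
theorem ok_of (W : ℕ) {k : ℕ} {T : Template} {m : ℕ} {w : ℕ → ℕ ⊕ ℕ} (hP : pieces W k = ⟨T, m, w⟩) (hwf : T.WF m)
    (h : ∀ i < m, (∀ a, w i = Sum.inl a → a < 4 * W + 1) ∧ (∀ g, w i = Sum.inr g → g < offset (pieces W) k)) :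
    Piece.OK (pieces W) (4 * W + 1) k := by
  unfold Piece.OK; rw [hP]; exact ⟨hwf, h⟩

/-- Every piece is well formed and well wired. [cite: Vollmer1999, Def. 1.6] -/
theorem piece_ok (W : ℕ) : ∀ k < 10, Piece.OK (pieces W) (4 * W + 1) k := by
  obtain ⟨h1, h2, h3, h4, h5, h6, h7, h8, h9, -⟩ := offsets W
  intro k hk
  have hk' : k = 0 ∨ k = 1 ∨ k = 2 ∨ k = 3 ∨ k = 4 ∨ k = 5 ∨ k = 6 ∨ k = 7 ∨ k = 8 ∨ k = 9 := by omega
  rcases hk' with rfl | rfl | rfl | rfl | rfl | rfl | rfl | rfl | rfl | rfl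
  · refine ⟨?_, fun i hi => absurd hi (Nat.not_lt_zero i)⟩
    intro k hk
    simp only [pieces, List.length_singleton, Nat.lt_one_iff] at hk
    subst hk
    exact ⟨rfl, fun a ha => absurd ha List.not_mem_nil⟩
  · refine ok_of W rfl (Adder.wf_addT false W) fun i hi => ?_
    unfold wYX; split_ifs <;> exact ⟨fun a ha => (by cases ha; omega), fun g hg => by cases hg⟩
  · refine ok_of W rfl (Adder.wf_addT false W) fun i hi => ?_
    unfold wNX; split_ifs <;> exact ⟨fun a ha => (by cases ha; omega), fun g hg => by cases hg⟩
  · refine ok_of W rfl (Sub.wf_subT (W + 1)) fun i hi => ?_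
    rw [h3]; unfold wT1; split_ifs <;> exact ⟨fun a ha => (by cases ha), fun g hg => by cases hg; omega⟩
  · refine ok_of W rfl (Adder.wf_addT false (W + 1)) fun i hi => ?_
    rw [h4]; unfold wE; split_ifs
    · exact ⟨fun a ha => (by cases ha; omega), fun g hg => by cases hg⟩
    · exact ⟨fun a ha => (by cases ha; omega), fun g hg => by cases hg⟩
    · exact ⟨fun a ha => (by cases ha), fun g hg => by cases hg; omega⟩
  · refine ok_of W rfl (Adder.wf_addT false (W + 1)) fun i hi => ?_
    rw [h5]; unfold wXN; split_ifs
    · exact ⟨fun a ha => (by cases ha; omega), fun g hg => by cases hg⟩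
    · exact ⟨fun a ha => (by cases ha), fun g hg => by cases hg; omega⟩
    · exact ⟨fun a ha => (by cases ha; omega), fun g hg => by cases hg⟩
    · exact ⟨fun a ha => (by cases ha), fun g hg => by cases hg; omega⟩
  · refine ok_of W rfl (Sub.wf_subT (W + 2)) fun i hi => ?_
    rw [h6]; unfold wT2; split_ifs <;> exact ⟨fun a ha => (by cases ha), fun g hg => by cases hg; omega⟩
  · refine ok_of W rfl (Sub.wf_subT (W + 1)) fun i hi => ?_
    rw [h7]; unfold wCDX; split_ifs
    · exact ⟨fun a ha => (by cases ha; omega), fun g hg => by cases hg⟩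
    · exact ⟨fun a ha => (by cases ha; omega), fun g hg => by cases hg⟩
    · exact ⟨fun a ha => (by cases ha), fun g hg => by cases hg; omega⟩
  · refine ok_of W rfl (Sub.wf_subT (W + 1)) fun i hi => ?_
    rw [h8]; unfold wCXN; split_ifs
    · exact ⟨fun a ha => (by cases ha; omega), fun g hg => by cases hg⟩
    · exact ⟨fun a ha => (by cases ha), fun g hg => by cases hg; omega⟩
    · exact ⟨fun a ha => (by cases ha; omega), fun g hg => by cases hg⟩
    · exact ⟨fun a ha => (by cases ha), fun g hg => by cases hg; omega⟩
  · refine ok_of W rfl (Sub.wf_subT (W + 1)) fun i hi => ?_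
    rw [h9]; unfold wCD; split_ifs
    · exact ⟨fun a ha => (by cases ha; omega), fun g hg => by cases hg⟩
    · exact ⟨fun a ha => (by cases ha; omega), fun g hg => by cases hg⟩
    · exact ⟨fun a ha => (by cases ha), fun g hg => by cases hg; omega⟩

end DomAux

/-- **The auxiliary template is well formed** (`4W + 1` inputs). [cite: Vollmer1999, Def. 1.6] -/
theorem wf_domAuxT (W : ℕ) : (domAuxT W).WF (4 * W + 1) := wf_layout (DomAux.pieces W) (DomAux.piece_ok W)

/-- Size of the auxiliary template: `23W + 32` gates. [folklore] -/
@[simp] theorem length_domAuxT (W : ℕ) : (domAuxT W).length = 23 * W + 32 := by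
  rw [domAuxT, length_layout]; exact (DomAux.offsets W).2.2.2.2.2.2.2.2.2

/-! ### Views of the auxiliary occurrence -/

namespace DomAux

variable (W : ℕ) (o a : Occ)

/-- The `⊥` gate of the auxiliary occurrence. [folklore] -/
def fa : ℕ := a.base

/-- `y + x`. [folklore] -/
def YX : Adder.View := ⟨a.base + 1, fun i => o.inp (W + i), o.inp⟩

/-- `n + x`. [folklore] -/
def NX : Adder.View := ⟨a.base + (2 * W + 2), nv W o, o.inp⟩

/-- The comparator of `y + x` with `n + x` (`W+1` bits). [folklore] -/
def T1 : Sub.View := ⟨a.base + (4 * W + 3), Adder.extOut (YX W o a) W, Adder.extOut (NX W o a) W⟩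

/-- `d + n` (`W+1` bits). [folklore] -/
def E : Adder.View := ⟨a.base + (7 * W + 7), d W o, Adder.zext (nv W o) (fa a) W⟩

/-- `x + n` on zero-extended operands (`W+1` bits). [folklore] -/
def XN : Adder.View := ⟨a.base + (9 * W + 10), Adder.zext o.inp (fa a) W, Adder.zext (nv W o) (fa a) W⟩

/-- The comparator of `d + n` with `x + n` (`W+2` bits). [folklore] -/
def T2 : Sub.View := ⟨a.base + (11 * W + 13), Adder.extOut (E W o a) (W + 1), Adder.extOut (XN W o a) (W + 1)⟩

/-- The comparator of `d` with `x` (`W+1` bits). [folklore] -/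
def CDX : Sub.View := ⟨a.base + (14 * W + 20), d W o, Adder.zext o.inp (fa a) W⟩

/-- The comparator of `x` with `n` (`W+1` bits). [folklore] -/
def CXN : Sub.View := ⟨a.base + (17 * W + 24), Adder.zext o.inp (fa a) W, Adder.zext (nv W o) (fa a) W⟩

/-- The comparator of `d` with `n` (`W+1` bits). [folklore] -/
def CD : Sub.View := ⟨a.base + (20 * W + 28), d W o, Adder.zext (nv W o) (fa a) W⟩

/-- `Wired W o a`: the inputs of the auxiliary occurrence `a` are the words `x, y, n` and the
difference wires of the occurrence `o`. [folklore] -/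
structure Wired : Prop where
  /-- `x` -/
  hx : ∀ i < W, a.inp i = o.inp i
  /-- `y` -/
  hy : ∀ i < W, a.inp (W + i) = o.inp (W + i)
  /-- `n` -/
  hn : ∀ i < W, a.inp (2 * W + i) = o.inp (2 * W + i)
  /-- the difference bits -/
  hd : ∀ i < W + 1, a.inp (3 * W + i) = d W o i

/-- `AuxViews W o a K Γ`: the definition lines of all pieces of the auxiliary occurrence are
available, in view form. [folklore] -/
structure AuxViews (K : PropForm ℕ) (Γ : Set (PropForm ℕ)) : Prop where
  /-- the `⊥` gate -/
  bot : ctx K (biimp (var (fa a)) (const false)) ∈ Γ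
  /-- `y + x` -/
  yx : (YX W o a).Avail K Γ false W
  /-- `n + x` -/
  nx : (NX W o a).Avail K Γ false W
  /-- comparator of `y + x` with `n + x` -/
  t1 : (T1 W o a).Avail K Γ (W + 1)
  /-- `d + n` -/
  e : (E W o a).Avail K Γ false (W + 1)
  /-- `x + n` -/
  xn : (XN W o a).Avail K Γ false (W + 1)
  /-- comparator of `d + n` with `x + n` -/
  t2 : (T2 W o a).Avail K Γ (W + 2)
  /-- comparator of `d` with `x` -/
  cdx : (CDX W o a).Avail K Γ (W + 1)
  /-- comparator of `x` with `n` -/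
  cxn : (CXN W o a).Avail K Γ (W + 1)
  /-- comparator of `d` with `n` -/
  cd : (CD W o a).Avail K Γ (W + 1)

variable {W o a}

/-- Availability of the auxiliary views is monotone. [folklore] -/
theorem AuxViews.mono {K : PropForm ℕ} {Γ Γ' : Set (PropForm ℕ)} (h : AuxViews W o a K Γ) (hΓ : Γ ⊆ Γ') :
    AuxViews W o a K Γ' :=
  ⟨hΓ h.bot, h.yx.mono hΓ, h.nx.mono hΓ, h.t1.mono hΓ, h.e.mono hΓ, h.xn.mono hΓ, h.t2.mono hΓ, h.cdx.mono hΓ,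
    h.cxn.mono hΓ, h.cd.mono hΓ⟩

/-- **An available, correctly wired auxiliary occurrence provides all auxiliary views.** [folklore] -/
theorem auxAvail {K : PropForm ℕ} {Γ : Set (PropForm ℕ)} (ha : a.Avail (domAuxT W) (4 * W + 1) K Γ) (hw : Wired W o a) :
    AuxViews W o a K Γ := by
  obtain ⟨h1, h2, h3, h4, h5, h6, h7, h8, h9, -⟩ := offsets W
  have hI : (a.inst (4 * W + 1)).DefsAvail (layout (pieces W) 10) K Γ := ha
  have href : ∀ i < 4 * W + 1, (a.inst (4 * W + 1)).ref (Sum.inl i) = a.inp i := fun i hi => a.ref_inl hi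
  -- the reference values of the wirings, as words of `o`
  have rx : ∀ i < W, (a.inst (4 * W + 1)).ref (Sum.inl i) = o.inp i := fun i hi => by rw [href i (by omega), hw.hx i hi]
  have ry : ∀ i < W, (a.inst (4 * W + 1)).ref (Sum.inl (W + i)) = o.inp (W + i) := fun i hi => by
    rw [href _ (by omega), hw.hy i hi]
  have rn : ∀ i < W, (a.inst (4 * W + 1)).ref (Sum.inl (2 * W + i)) = nv W o i := fun i hi => by
    rw [href _ (by omega), hw.hn i hi]; rfl
  have rd : ∀ i < W + 1, (a.inst (4 * W + 1)).ref (Sum.inl (3 * W + i)) = d W o i := fun i hi => by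
    rw [href _ (by omega), hw.hd i hi]
  have rg : ∀ g, (a.inst (4 * W + 1)).ref (Sum.inr g) = a.base + g := fun g => rfl
  refine ⟨?_, ?_, ?_, ?_, ?_, ?_, ?_, ?_, ?_, ?_⟩
  · -- the `⊥` gate, piece 0 at offset 0
    obtain ⟨hk, heq⟩ := getElem_layout (pieces W) (k := 0) (N := 10) (j := 0) (by omega) (by simp [pieces])
    have h := hI (offset (pieces W) 0 + 0) hk
    rw [heq] at h
    exact h
  · -- `y + x`, piece 1
    have h := Adder.avail_viewEmb (c₀ := false) (W := W) (off := offset (pieces W) 1) (w := wYX W) hI fun k hk =>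
      getElem_layout (pieces W) (k := 1) (N := 10) (by omega) hk
    rw [h1] at h
    refine h.congr rfl (fun i hi => ?_) fun i hi => ?_
    · show o.inp (W + i) = (a.inst (4 * W + 1)).ref (wYX W i)
      rw [wYX, if_pos hi, ry i hi]
    · show o.inp i = (a.inst (4 * W + 1)).ref (wYX W (W + i))
      rw [wYX, if_neg (by omega), show W + i - W = i by omega, rx i hi]
  · -- `n + x`, piece 2
    have h := Adder.avail_viewEmb (c₀ := false) (W := W) (off := offset (pieces W) 2) (w := wNX W) hI fun k hk =>
      getElem_layout (pieces W) (k := 2) (N := 10) (by omega) hk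
    rw [h2] at h
    refine h.congr rfl (fun i hi => ?_) fun i hi => ?_
    · show nv W o i = (a.inst (4 * W + 1)).ref (wNX W i)
      rw [wNX, if_pos hi, rn i hi]
    · show o.inp i = (a.inst (4 * W + 1)).ref (wNX W (W + i))
      rw [wNX, if_neg (by omega), show W + i - W = i by omega, rx i hi]
  · -- comparator of `y + x` with `n + x`, piece 3
    have h := Sub.avail_viewEmb (w := W + 1) (off := offset (pieces W) 3) (wv := wT1 W) hI fun k hk =>
      getElem_layout (pieces W) (k := 3) (N := 10) (by omega) hk
    rw [h3] at h
    refine h.congr rfl (fun i hi => ?_) fun i hi => ?_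
    · show Adder.extOut (YX W o a) W i = (a.inst (4 * W + 1)).ref (wT1 W i)
      rcases Nat.lt_succ_iff_lt_or_eq.1 hi with hi' | hi'
      · rw [Adder.extOut_lt _ hi', wT1, if_pos hi', rg]; simp [YX, Adder.View.s, Adder.View.wire, Nat.add_assoc]
      · rw [hi', Adder.extOut_top, wT1, if_neg (lt_irrefl W), if_pos rfl, rg]; simp [YX, Adder.View.c, Adder.View.wire, Nat.add_assoc]
    · show Adder.extOut (NX W o a) W i = (a.inst (4 * W + 1)).ref (wT1 W (W + 1 + i))
      rcases Nat.lt_succ_iff_lt_or_eq.1 hi with hi' | hi'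
      · rw [Adder.extOut_lt _ hi', wT1, if_neg (by omega), if_neg (by omega), if_pos (by omega), rg,
          show W + 1 + i - (W + 1) = i by omega]
        simp [NX, Adder.View.s, Adder.View.wire, Nat.add_assoc]
      · rw [hi', Adder.extOut_top, wT1, if_neg (by omega), if_neg (by omega), if_neg (by omega), rg]
        simp [NX, Adder.View.c, Adder.View.wire, Nat.add_assoc]
  · -- `d + n`, piece 4
    have h := Adder.avail_viewEmb (c₀ := false) (W := W + 1) (off := offset (pieces W) 4) (w := wE W) hI fun k hk =>
      getElem_layout (pieces W) (k := 4) (N := 10) (by omega) hk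
    rw [h4] at h
    refine h.congr rfl (fun i hi => ?_) fun i hi => ?_
    · show d W o i = (a.inst (4 * W + 1)).ref (wE W i)
      rw [wE, if_pos hi, rd i hi]
    · show Adder.zext (nv W o) (fa a) W i = (a.inst (4 * W + 1)).ref (wE W (W + 1 + i))
      rcases Nat.lt_succ_iff_lt_or_eq.1 hi with hi' | hi'
      · rw [Adder.zext_lt _ _ hi', wE, if_neg (by omega), if_pos (by omega), show W + 1 + i - (W + 1) = i by omega, rn i hi']
      · rw [hi', Adder.zext_top, wE, if_neg (by omega), if_neg (by omega), rg]; rfl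
  · -- `x + n`, piece 5
    have h := Adder.avail_viewEmb (c₀ := false) (W := W + 1) (off := offset (pieces W) 5) (w := wXN W) hI fun k hk =>
      getElem_layout (pieces W) (k := 5) (N := 10) (by omega) hk
    rw [h5] at h
    refine h.congr rfl (fun i hi => ?_) fun i hi => ?_
    · show Adder.zext o.inp (fa a) W i = (a.inst (4 * W + 1)).ref (wXN W i)
      rcases Nat.lt_succ_iff_lt_or_eq.1 hi with hi' | hi'
      · rw [Adder.zext_lt _ _ hi', wXN, if_pos hi', rx i hi']
      · rw [hi', Adder.zext_top, wXN, if_neg (lt_irrefl W), if_pos rfl, rg]; rfl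
    · show Adder.zext (nv W o) (fa a) W i = (a.inst (4 * W + 1)).ref (wXN W (W + 1 + i))
      rcases Nat.lt_succ_iff_lt_or_eq.1 hi with hi' | hi'
      · rw [Adder.zext_lt _ _ hi', wXN, if_neg (by omega), if_neg (by omega), if_pos (by omega),
          show W + 1 + i - (W + 1) = i by omega, rn i hi']
      · rw [hi', Adder.zext_top, wXN, if_neg (by omega), if_neg (by omega), if_neg (by omega), rg]; rfl
  · -- comparator of `d + n` with `x + n`, piece 6
    have h := Sub.avail_viewEmb (w := W + 2) (off := offset (pieces W) 6) (wv := wT2 W) hI fun k hk =>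
      getElem_layout (pieces W) (k := 6) (N := 10) (by omega) hk
    rw [h6] at h
    refine h.congr rfl (fun i hi => ?_) fun i hi => ?_
    · show Adder.extOut (E W o a) (W + 1) i = (a.inst (4 * W + 1)).ref (wT2 W i)
      rcases Nat.lt_succ_iff_lt_or_eq.1 hi with hi' | hi'
      · rw [Adder.extOut_lt _ hi', wT2, if_pos hi', rg]; simp [E, Adder.View.s, Adder.View.wire, Nat.add_assoc]
      · rw [hi', Adder.extOut_top, wT2, if_neg (lt_irrefl _), if_pos rfl, rg]; simp [E, Adder.View.c, Adder.View.wire, Nat.add_assoc]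
    · show Adder.extOut (XN W o a) (W + 1) i = (a.inst (4 * W + 1)).ref (wT2 W (W + 2 + i))
      rcases Nat.lt_succ_iff_lt_or_eq.1 hi with hi' | hi'
      · rw [Adder.extOut_lt _ hi', wT2, if_neg (by omega), if_neg (by omega), if_pos (by omega), rg,
          show W + 2 + i - (W + 2) = i by omega]
        simp [XN, Adder.View.s, Adder.View.wire, Nat.add_assoc]
      · rw [hi', Adder.extOut_top, wT2, if_neg (by omega), if_neg (by omega), if_neg (by omega), rg]
        simp [XN, Adder.View.c, Adder.View.wire, Nat.add_assoc]
  · -- comparator of `d` with `x`, piece 7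
    have h := Sub.avail_viewEmb (w := W + 1) (off := offset (pieces W) 7) (wv := wCDX W) hI fun k hk =>
      getElem_layout (pieces W) (k := 7) (N := 10) (by omega) hk
    rw [h7] at h
    refine h.congr rfl (fun i hi => ?_) fun i hi => ?_
    · show d W o i = (a.inst (4 * W + 1)).ref (wCDX W i)
      rw [wCDX, if_pos hi, rd i hi]
    · show Adder.zext o.inp (fa a) W i = (a.inst (4 * W + 1)).ref (wCDX W (W + 1 + i))
      rcases Nat.lt_succ_iff_lt_or_eq.1 hi with hi' | hi'
      · rw [Adder.zext_lt _ _ hi', wCDX, if_neg (by omega), if_pos (by omega), show W + 1 + i - (W + 1) = i by omega, rx i hi']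
      · rw [hi', Adder.zext_top, wCDX, if_neg (by omega), if_neg (by omega), rg]; rfl
  · -- comparator of `x` with `n`, piece 8
    have h := Sub.avail_viewEmb (w := W + 1) (off := offset (pieces W) 8) (wv := wCXN W) hI fun k hk =>
      getElem_layout (pieces W) (k := 8) (N := 10) (by omega) hk
    rw [h8] at h
    refine h.congr rfl (fun i hi => ?_) fun i hi => ?_
    · show Adder.zext o.inp (fa a) W i = (a.inst (4 * W + 1)).ref (wCXN W i)
      rcases Nat.lt_succ_iff_lt_or_eq.1 hi with hi' | hi'
      · rw [Adder.zext_lt _ _ hi', wCXN, if_pos hi', rx i hi']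
      · rw [hi', Adder.zext_top, wCXN, if_neg (lt_irrefl W), if_pos rfl, rg]; rfl
    · show Adder.zext (nv W o) (fa a) W i = (a.inst (4 * W + 1)).ref (wCXN W (W + 1 + i))
      rcases Nat.lt_succ_iff_lt_or_eq.1 hi with hi' | hi'
      · rw [Adder.zext_lt _ _ hi', wCXN, if_neg (by omega), if_neg (by omega), if_pos (by omega),
          show W + 1 + i - (W + 1) = i by omega, rn i hi']
      · rw [hi', Adder.zext_top, wCXN, if_neg (by omega), if_neg (by omega), if_neg (by omega), rg]; rfl
  · -- comparator of `d` with `n`, piece 9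
    have h := Sub.avail_viewEmb (w := W + 1) (off := offset (pieces W) 9) (wv := wCD W) hI fun k hk =>
      getElem_layout (pieces W) (k := 9) (N := 10) (by omega) hk
    rw [h9] at h
    refine h.congr rfl (fun i hi => ?_) fun i hi => ?_
    · show d W o i = (a.inst (4 * W + 1)).ref (wCD W i)
      rw [wCD, if_pos hi, rd i hi]
    · show Adder.zext (nv W o) (fa a) W i = (a.inst (4 * W + 1)).ref (wCD W (W + 1 + i))
      rcases Nat.lt_succ_iff_lt_or_eq.1 hi with hi' | hi'
      · rw [Adder.zext_lt _ _ hi', wCD, if_neg (by omega), if_pos (by omega), show W + 1 + i - (W + 1) = i by omega, rn i hi']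
      · rw [hi', Adder.zext_top, wCD, if_neg (by omega), if_neg (by omega), rg]; rfl

/-! ### Small generic steps -/

section Steps

variable {G : FregeSystem} {K : PropForm ℕ} {Γ : Set (PropForm ℕ)}

/-- **Transport of a negative literal backwards along an equality**: `¬a` and `b ↔ a` give `¬b`
(symmetry, then transport). [cite: CookReckhow1979, §2] -/
theorem negTransport (hG : RulesOK G) {x y : ℕ} (h₁ : ctx K (neg (var x)) ∈ Γ) (h₂ : ctx K (eqv y x) ∈ Γ) :
    G.Yields Γ {ctx K (neg (var y))} (2 * (K.size + 10)) := by
  have ha : G.Yields Γ {ctx K (eqv x y)} (K.size + 10) := by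
    have h := Yields.single (Logic.infer hG.logic 5 (by decide) (S := Γ) (FregeSystem.sub [K, var y, var x])
      (θ := ctx K (eqv x y)) rfl (FregeSystem.prems_cons h₂ FregeSystem.prems_nil))
    exact h.mono_size (by simp [ctx, eqv, size, FregeSystem.size_biimp])
  have hb : G.Yields (Γ ∪ {ctx K (eqv x y)}) {ctx K (neg (var y))} (K.size + 10) := by
    have h := Yields.single (Logic.infer hG.logic 8 (by decide) (S := Γ ∪ {ctx K (eqv x y)}) (FregeSystem.sub [K, var x, var y])
      (θ := ctx K (neg (var y))) rfl (FregeSystem.prems_cons (Or.inl h₁) (FregeSystem.prems_cons (Or.inr rfl) FregeSystem.prems_nil)))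
    exact h.mono_size (by simp [ctx, size])
  exact ((ha.trans hb).mono_right Set.subset_union_right).mono_size (by omega)

/-- `b ↔ ¬g` and `g` give `¬b`. [cite: CookReckhow1979, §2] -/
theorem negOfEqvNeg (hG : RulesOK G) {b g : ℕ} (h₁ : ctx K (biimp (var b) (neg (var g))) ∈ Γ) (h₂ : ctx K (var g) ∈ Γ) :
    G.Yields Γ {ctx K (neg (var b))} (K.size + 3) := by
  have h := Yields.single (FregeSystem.IsInferredFrom.of_rule (hG.modAdd _ mem_rules.2.2.2.1) (S := Γ)
    (FregeSystem.sub [K, var b, var g]) (θ := ctx K (neg (var b))) rfl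
    (FregeSystem.prems_cons h₁ (FregeSystem.prems_cons h₂ FregeSystem.prems_nil)))
  exact h.mono_size (by simp [ctx, size])

/-- **The top position of an adder on zero-extended operands**: `s_W ↔ c_W` and `¬c_{W+1}`.
[cite: CookReckhow1979, §2] -/
theorem extTop (hG : RulesOK G) (P : Adder.View) {W : ℕ} (hP : P.Avail K Γ false (W + 1)) {fz : ℕ} (hxW : P.x W = fz)
    (hyW : P.y W = fz) (hf : ctx K (neg (var fz)) ∈ Γ) :
    G.Yields Γ ({ctx K (eqv (P.s W) (P.c W))} ∪ {ctx K (neg (var (P.c (W + 1))))}) ((K.size + 10) + (K.size + 3)) := by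
  have hs := (hP.2 W (Nat.lt_succ_self W)).1
  have hc := (hP.2 W (Nat.lt_succ_self W)).2
  rw [Adder.View.sumDef, hxW, hyW] at hs
  rw [Adder.View.carryDef, hxW, hyW] at hc
  refine Yields.union ?_ ?_
  · have h := Yields.single (FregeSystem.IsInferredFrom.of_rule (hG.modAdd _ mem_rules.2.2.2.2.2.1) (S := Γ)
      (FregeSystem.sub [K, var (P.s W), var fz, var (P.c W)]) (θ := ctx K (eqv (P.s W) (P.c W))) rfl
      (FregeSystem.prems_cons hs (FregeSystem.prems_cons hf FregeSystem.prems_nil)))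
    exact h.mono_size (by simp [ctx, eqv, size, FregeSystem.size_biimp])
  · have h := Yields.single (FregeSystem.IsInferredFrom.of_rule (hG.modAdd _ mem_rules.2.2.2.2.2.2) (S := Γ)
      (FregeSystem.sub [K, var (P.c (W + 1)), var fz, var (P.c W)]) (θ := ctx K (neg (var (P.c (W + 1))))) rfl
      (FregeSystem.prems_cons hc (FregeSystem.prems_cons hf FregeSystem.prems_nil)))
    exact h.mono_size (by simp [ctx, size])

end Steps

/-! ### The two cases -/

section Cases

variable {G : FregeSystem} {K : PropForm ℕ} {Γ : Set (PropForm ℕ)} {W : ℕ} {o a : Occ}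

/-- **Case `G` (the selector is true): `u = d < n`.** Under any context `K` in which the views, the
selector, `c_{W+1}(E) ↔ ¬G`, `¬ge_{W+1}(T2)`, `¬c_{W+1}(XN)`, `x < n` on `W+1` bits, the literal of
the auxiliary `⊥` gate and the reflexivity of `n` are available, the domain wire is provably false.
[cite: CookReckhow1979, §2] [cite: Krajicek1995, §9.2] -/
theorem caseSel (hG : RulesOK G) (v : Views W o K Γ) (av : AuxViews W o a K Γ) (hsel : ctx K (var (sel W o)) ∈ Γ)
    (hEc : ctx K (biimp (var ((E W o a).c (W + 1))) (neg (var (sel W o)))) ∈ Γ)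
    (hT2 : ctx K (neg (var ((T2 W o a).ge (W + 2) (W + 1)))) ∈ Γ)
    (hXNc : ctx K (neg (var ((XN W o a).c (W + 1)))) ∈ Γ)
    (hCXN : ctx K (neg (var ((CXN W o a).ge (W + 1) (W + 1)))) ∈ Γ)
    (hfa : ctx K (neg (var (fa a))) ∈ Γ) (hrn : Holds K Γ (eqW (nv W o) (nv W o) W)) :
    G.Yields Γ {ctx K (neg (var (domv W o)))} ((9 * W + 40) * (K.size + 60)) := by
  -- g2: the adder `d + n` does not overflow
  have g2 := negOfEqvNeg hG hEc hsel
  set Γ₂ := Γ ∪ {ctx K (neg (var ((E W o a).c (W + 1))))} with hΓ₂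
  -- g3: the top position of `T2`, hence `d + n < x + n`
  have g3a : G.Yields Γ₂ {ctx K (eqv ((T2 W o a).ge (W + 2) (W + 2)) ((T2 W o a).ge (W + 2) (W + 1)))} (K.size + 10) := by
    refine topEqv hG (T2 W o a) (av.t2.mono Set.subset_union_left) ?_ ?_
    · show ctx K (neg (var (Adder.extOut (E W o a) (W + 1) (W + 1)))) ∈ Γ₂
      rw [Adder.extOut_top]; exact Or.inr rfl
    · show ctx K (neg (var (Adder.extOut (XN W o a) (W + 1) (W + 1)))) ∈ Γ₂
      rw [Adder.extOut_top]; exact Or.inl hXNc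
  have g3 := g3a.trans (negTransport hG (K := K) (x := (T2 W o a).ge (W + 2) (W + 1)) (y := (T2 W o a).ge (W + 2) (W + 2))
    (Or.inl (Or.inl hT2)) (Or.inr rfl))
  set A3 : Set (PropForm ℕ) := {ctx K (neg (var ((E W o a).c (W + 1))))} ∪
    ({ctx K (eqv ((T2 W o a).ge (W + 2) (W + 2)) ((T2 W o a).ge (W + 2) (W + 1)))} ∪
      {ctx K (neg (var ((T2 W o a).ge (W + 2) (W + 2))))}) with hA3
  -- g4: monotonicity reversed: `d < x`
  let md : Sub.MonoData := ⟨(CDX W o a).base, (E W o a).base, (XN W o a).base, (T2 W o a).base, d W o,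
    Adder.zext o.inp (fa a) W, Adder.zext (nv W o) (fa a) W, W + 1⟩
  have g4 : G.Yields (Γ ∪ A3) {ctx K (neg (var ((CDX W o a).ge (W + 1) (W + 1))))} ((W + 1 + 2) * (K.size + 55)) := by
    have hΓΓ₃ : Γ ⊆ Γ ∪ A3 := Set.subset_union_left
    refine Yields.of_isBlock (Sub.MonoData.isBlock_monoRev hG.order md (av.cdx.mono hΓΓ₃) (av.e.mono hΓΓ₃) (av.xn.mono hΓΓ₃)
      (av.t2.mono hΓΓ₃) (Or.inr (Or.inr (Or.inr rfl)))) (fun θ hθ => ?_) (Sub.MonoData.proofSize_mono md K _)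
    rw [Set.mem_singleton_iff.1 hθ]; exact List.mem_append_right _ (List.mem_singleton_self _)
  set A4 := A3 ∪ {ctx K (neg (var ((CDX W o a).ge (W + 1) (W + 1))))} with hA4
  -- g5: transitivity with `x < n`: `d < n`
  let td : Sub.TransData := ⟨(CDX W o a).base, (CXN W o a).base, (CD W o a).base, d W o, Adder.zext o.inp (fa a) W,
    Adder.zext (nv W o) (fa a) W, W + 1⟩
  have g5 : G.Yields (Γ ∪ A4) {ctx K (neg (var ((CD W o a).ge (W + 1) (W + 1))))} ((W + 1 + 2) * (K.size + 8)) := by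
    have hΓΓ₄ : Γ ⊆ Γ ∪ A4 := Set.subset_union_left
    refine Yields.of_isBlock (Sub.TransData.isBlock_lines hG.order td (av.cdx.mono hΓΓ₄) (av.cxn.mono hΓΓ₄) (av.cd.mono hΓΓ₄)
      (Or.inr (Or.inr rfl)) (hΓΓ₄ hCXN)) (fun θ hθ => ?_) (Sub.TransData.proofSize_lines td K)
    rw [Set.mem_singleton_iff.1 hθ]; exact Sub.TransData.mem_lines td K
  set A5 := A4 ∪ {ctx K (neg (var ((CD W o a).ge (W + 1) (W + 1))))} with hA5
  -- g6: the top bit of `d` vanishes and `d < n` on the low `W` bits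
  have g6 : G.Yields (Γ ∪ A5) ({ctx K (neg (var ((CD W o a).x W)))} ∪ {ctx K (neg (var ((CD W o a).ge (W + 1) W)))}) (2 * (K.size + 3)) := by
    refine Yields.of_isBlock (Sub.isBlock_topBit hG.order (CD W o a) (av.cd.mono Set.subset_union_left) ?_ (Or.inr (Or.inr rfl)))
      (fun θ hθ => ?_) ?_
    · show ctx K (neg (var (Adder.zext (nv W o) (fa a) W W))) ∈ Γ ∪ A5
      rw [Adder.zext_top]; exact Or.inl hfa
    · rcases hθ with hθ | hθ <;> rw [Set.mem_singleton_iff.1 hθ] <;> simp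
    · simp [proofSize, ctx, size]; omega
  set A6 := A5 ∪ ({ctx K (neg (var ((CD W o a).x W)))} ∪ {ctx K (neg (var ((CD W o a).ge (W + 1) W)))}) with hA6
  -- g7: the multiplexers select `d`
  have g7 : G.Yields (Γ ∪ A6) (ctxSet K (eqW (u W o) (d W o) W)) (W * (K.size + 10)) :=
    Yields.muxRelW_true hG.logic (w₂ := (A W o).s) (holds_muxRelW_iff.2 fun i hi => Or.inl (v.mux i hi)) (Or.inl hsel)
  set A7 := A6 ∪ ctxSet K (eqW (u W o) (d W o) W) with hA7
  -- g8: link the domain comparator with the low part of `CD`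
  have g8 : G.Yields (Γ ∪ A7) (ctxSet K (linkLines (C W o) (CD W o a) W (W + 1) W)) ((3 * W + 1) * (K.size + 10)) := by
    refine linkLow hG (C W o) (CD W o a) (v.domc.mono Set.subset_union_left) (av.cd.mono Set.subset_union_left) le_rfl
      (Nat.le_succ W) (fun i hi => ?_) fun i hi => ?_
    · exact Or.inr (Or.inr (mem_ctxSet (mem_eqW hi)))
    · show ctx K (eqv (nv W o i) (Adder.zext (nv W o) (fa a) W i)) ∈ Γ ∪ A7
      rw [Adder.zext_lt _ _ hi]; exact Or.inl (holds_eqW_iff.1 hrn i hi)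
  set A8 := A7 ∪ ctxSet K (linkLines (C W o) (CD W o a) W (W + 1) W) with hA8
  have g9 : G.Yields (Γ ∪ A8) {ctx K (neg (var (domv W o)))} (2 * (K.size + 10)) :=
    negTransport hG (Or.inr (Or.inl (Or.inl (Or.inr (Or.inr rfl))))) (Or.inr (Or.inr (mem_ctxSet (ge_mem_linkLines _ _ _ _ _))))
  have h := ((((((g2.trans g3).trans g4).trans g5).trans g6).trans g7).trans g8).trans g9
  refine (h.mono_right ?_).mono_size (by nlinarith)
  intro θ hθ; exact Or.inr hθ

/-- **Case `¬G` (the selector is false): `u = s < n`.** Under any context `K` in which the views,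
`¬G`, the literal of the `⊥` gate and the reflexivity of `n` are available, the domain wire is
provably false. [cite: CookReckhow1979, §2] [cite: Krajicek1995, §9.2] -/
theorem caseNotSel (hG : RulesOK G) (v : Views W o K Γ) (hnsel : ctx K (neg (var (sel W o))) ∈ Γ)
    (hf : ctx K (neg (var (f W o))) ∈ Γ) (hrn : Holds K Γ (eqW (nv W o) (nv W o) W)) :
    G.Yields Γ {ctx K (neg (var (domv W o)))} ((4 * W + 5) * (K.size + 10)) := by
  -- h2: the top bit of `s` vanishes and `s < n` on the low `W` bits
  have h2 : G.Yields Γ ({ctx K (neg (var ((S W o).x W)))} ∪ {ctx K (neg (var ((S W o).ge (W + 1) W)))}) (2 * (K.size + 3)) := by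
    refine Yields.of_isBlock (Sub.isBlock_topBit hG.order (S W o) v.cmp ?_ hnsel) (fun θ hθ => ?_) ?_
    · show ctx K (neg (var (Adder.zext (nv W o) (f W o) W W))) ∈ Γ
      rw [Adder.zext_top]; exact hf
    · rcases hθ with hθ | hθ <;> rw [Set.mem_singleton_iff.1 hθ] <;> simp
    · simp [proofSize, ctx, size]; omega
  set A2 : Set (PropForm ℕ) := {ctx K (neg (var ((S W o).x W)))} ∪ {ctx K (neg (var ((S W o).ge (W + 1) W)))} with hA2
  -- h3: the multiplexers select `s`
  have h3 : G.Yields (Γ ∪ A2) (ctxSet K (eqW (u W o) (A W o).s W)) (W * (K.size + 10)) :=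
    Yields.muxRelW_false hG.logic (w₁ := d W o) (holds_muxRelW_iff.2 fun i hi => Or.inl (v.mux i hi)) (Or.inl hnsel)
  set A3 := A2 ∪ ctxSet K (eqW (u W o) (A W o).s W) with hA3
  -- h4: link the domain comparator with the low part of `S`
  have h4 : G.Yields (Γ ∪ A3) (ctxSet K (linkLines (C W o) (S W o) W (W + 1) W)) ((3 * W + 1) * (K.size + 10)) := by
    refine linkLow hG (C W o) (S W o) (v.domc.mono Set.subset_union_left) (v.cmp.mono Set.subset_union_left) le_rfl
      (Nat.le_succ W) (fun i hi => ?_) fun i hi => ?_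
    · show ctx K (eqv (u W o i) (Adder.extOut (A W o) W i)) ∈ Γ ∪ A3
      rw [Adder.extOut_lt _ hi]; exact Or.inr (Or.inr (mem_ctxSet (mem_eqW hi)))
    · show ctx K (eqv (nv W o i) (Adder.zext (nv W o) (f W o) W i)) ∈ Γ ∪ A3
      rw [Adder.zext_lt _ _ hi]; exact Or.inl (holds_eqW_iff.1 hrn i hi)
  set A4 := A3 ∪ ctxSet K (linkLines (C W o) (S W o) W (W + 1) W) with hA4
  have h5 : G.Yields (Γ ∪ A4) {ctx K (neg (var (domv W o)))} (2 * (K.size + 10)) :=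
    negTransport hG (Or.inr (Or.inl (Or.inl (Or.inr rfl)))) (Or.inr (Or.inr (mem_ctxSet (ge_mem_linkLines _ _ _ _ _))))
  have h := ((h2.trans h3).trans h4).trans h5
  refine (h.mono_right ?_).mono_size (by nlinarith)
  intro θ hθ; exact Or.inr hθ

end Cases

end DomAux

/-! ### The case-free preparations -/

namespace DomAux

variable {G : FregeSystem} {K : PropForm ℕ} {Γ : Set (PropForm ℕ)} {W : ℕ} {o a : Occ}

/-- The two `⊥` gates are provably equal (both false). [cite: CookReckhow1979, §2] -/
theorem eqBot (hG : RulesOK G) (v : Views W o K Γ) (av : AuxViews W o a K Γ) :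
    G.Yields Γ {ctx K (eqv (fa a) (f W o))} (3 * (K.size + 10)) := by
  have t0 := (Yields.lit_of_cstDef hG.logic v.bot).union (Yields.lit_of_cstDef hG.logic av.bot)
  have t1 : G.Yields (Γ ∪ ({ctx K (lit (f W o) false)} ∪ {ctx K (lit (fa a) false)})) {ctx K (eqv (fa a) (f W o))} (K.size + 10) := by
    have h := Yields.single (Logic.infer hG.logic 10 (by decide) (S := Γ ∪ ({ctx K (lit (f W o) false)} ∪ {ctx K (lit (fa a) false)}))
      (FregeSystem.sub [K, var (fa a), var (f W o)]) (θ := ctx K (eqv (fa a) (f W o))) rfl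
      (FregeSystem.prems_cons (Or.inr (Or.inr rfl)) (FregeSystem.prems_cons (Or.inr (Or.inl rfl)) FregeSystem.prems_nil)))
    exact h.mono_size (by simp [ctx, eqv, size, FregeSystem.size_biimp])
  exact ((t0.trans t1).mono_right Set.subset_union_right).mono_size (by omega)

/-- **Subtract then add back**: `d + n = s`, and the carries of `E = d + n` complement the comparison
carries of `S` (from the equality of the `⊥` gates). [cite: CookReckhow1979, §2] -/
theorem subAdd (hG : RulesOK G) (v : Views W o K Γ) (av : AuxViews W o a K Γ) (hff : ctx K (eqv (fa a) (f W o)) ∈ Γ) :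
    G.Yields Γ {χ | χ ∈ Sub.subAddLines (S W o) (E W o a) K (W + 1)} ((5 * W + 4) * (K.size + 12)) := by
  have t0 := (Yields.eqW_refl hG.adder K (nv W o) W (Γ := Γ)).union (Yields.eqW_refl hG.adder K (d W o) (W + 1))
  have t1 : G.Yields (Γ ∪ (ctxSet K (eqW (nv W o) (nv W o) W) ∪ ctxSet K (eqW (d W o) (d W o) (W + 1))))
      {χ | χ ∈ Sub.subAddLines (S W o) (E W o a) K (W + 1)} ((2 * (W + 1) + 1) * (K.size + 12)) := by
    refine Yields.of_isBlock (Sub.isBlock_subAddLines hG.sub (S W o) (E W o a) (v.cmp.mono Set.subset_union_left)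
      (av.e.mono Set.subset_union_left) (fun i hi => Or.inr (Or.inr (mem_ctxSet (mem_eqW hi)))) fun i hi => ?_) subset_rfl
      (Sub.proofSize_subAddLines _ _ _ _)
    show ctx K (eqv (Adder.zext (nv W o) (fa a) W i) (Adder.zext (nv W o) (f W o) W i)) ∈ _
    rcases Nat.lt_succ_iff_lt_or_eq.1 hi with hi' | hi'
    · rw [Adder.zext_lt _ _ hi', Adder.zext_lt _ _ hi']; exact Or.inr (Or.inl (mem_ctxSet (mem_eqW hi')))
    · rw [hi', Adder.zext_top, Adder.zext_top]; exact Or.inl hff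
  exact ((t0.trans t1).mono_right Set.subset_union_right).mono_size (by nlinarith)

/-- `x + y` and `y + x` agree wire by wire. [cite: CookReckhow1979, §2] -/
theorem commAYX (hG : RulesOK G) (v : Views W o K Γ) (av : AuxViews W o a K Γ) :
    G.Yields Γ {χ | χ ∈ Adder.commLines (A W o) (YX W o a) K W} ((4 * W + 1) * (K.size + 10)) := by
  have t0 := Yields.eqW_refl hG.adder K o.inp (2 * W) (Γ := Γ)
  have t1 : G.Yields (Γ ∪ ctxSet K (eqW o.inp o.inp (2 * W))) {χ | χ ∈ Adder.commLines (A W o) (YX W o a) K W}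
      ((2 * W + 1) * (K.size + 10)) :=
    Yields.of_isBlock (Adder.isBlock_commLines hG.netlist hG.adder (A W o) (YX W o a) (v.adder.mono Set.subset_union_left)
      (av.yx.mono Set.subset_union_left) (fun i hi => Or.inr (mem_ctxSet (mem_eqW (show i < 2 * W by omega))))
      fun i hi => Or.inr (mem_ctxSet (mem_eqW (show W + i < 2 * W by omega)))) subset_rfl (Adder.proofSize_commLines _ _ _ _)
  exact ((t0.trans t1).mono_right Set.subset_union_right).mono_size (by nlinarith)

/-- `y + x < n + x` from the certificate of `y`. [cite: CookReckhow1979, §2] -/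
theorem mono1 (hG : RulesOK G) (av : AuxViews W o a K Γ) (hy : LtN W K Γ (fun i => o.inp (W + i)) (nv W o)) :
    G.Yields Γ {ctx K (neg (var ((T1 W o a).ge (W + 1) (W + 1))))} ((W + 2) * (K.size + 55)) := by
  obtain ⟨bS, hbS, hltS⟩ := hy
  let md : Sub.MonoData := ⟨bS, (YX W o a).base, (NX W o a).base, (T1 W o a).base, fun i => o.inp (W + i), nv W o, o.inp, W⟩
  refine Yields.of_isBlock (Sub.MonoData.isBlock_mono hG.order md hbS av.yx av.nx av.t1 hltS) (fun θ hθ => ?_)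
    (Sub.MonoData.proofSize_mono md K _)
  rw [Set.mem_singleton_iff.1 hθ]; exact List.mem_append_right _ (List.mem_singleton_self _)

/-- `n + x` and `x + n` (on zero-extended operands) agree on the wires below position `W`.
[cite: CookReckhow1979, §2] -/
theorem commNX (hG : RulesOK G) (av : AuxViews W o a K Γ) :
    G.Yields Γ (ctxSet K (eqW (NX W o a).wire (XN W o a).wire (2 * W + 1))) ((5 * W + 1) * (K.size + 10)) := by
  let XNl : Adder.View := ⟨(XN W o a).base, o.inp, nv W o⟩
  have hXNl : XNl.Avail K Γ false W :=
    (av.xn.of_le (Nat.le_succ W)).congr rfl (fun i hi => (Adder.zext_lt _ _ hi).symm) fun i hi => (Adder.zext_lt _ _ hi).symm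
  have t0 := Yields.eqW_refl hG.adder K o.inp (3 * W) (Γ := Γ)
  have t1 : G.Yields (Γ ∪ ctxSet K (eqW o.inp o.inp (3 * W))) (ctxSet K (eqW (NX W o a).wire (XN W o a).wire (2 * W + 1)))
      ((2 * W + 1) * (K.size + 10)) := by
    refine Yields.of_isBlock (Adder.isBlock_commLines hG.netlist hG.adder (NX W o a) XNl (av.nx.mono Set.subset_union_left)
      (hXNl.mono Set.subset_union_left) (fun i hi => Or.inr (mem_ctxSet (mem_eqW (show 2 * W + i < 3 * W by omega))))
      fun i hi => Or.inr (mem_ctxSet (mem_eqW (show i < 3 * W by omega)))) ?_ (Adder.proofSize_commLines _ _ _ _)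
    rintro θ ⟨L, hL, rfl⟩
    obtain ⟨k, hk, rfl⟩ := List.mem_map.1 hL
    exact Adder.mem_commLines (List.mem_range.1 hk)
  exact ((t0.trans t1).mono_right Set.subset_union_right).mono_size (by nlinarith)

/-- The top position of `x + n`: `s_W ↔ c_W` and `¬c_{W+1}`. [cite: CookReckhow1979, §2] -/
theorem topXN (hG : RulesOK G) (av : AuxViews W o a K Γ) :
    G.Yields Γ ({ctx K (eqv ((XN W o a).s W) ((XN W o a).c W))} ∪ {ctx K (neg (var ((XN W o a).c (W + 1))))}) (3 * (K.size + 10)) := by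
  have t0 := Yields.lit_of_cstDef hG.logic av.bot (Γ := Γ)
  have t1 := extTop hG (XN W o a) (av.xn.mono (Set.subset_union_left (t := {ctx K (lit (fa a) false)}))) (Adder.zext_top _ _ _)
    (Adder.zext_top _ _ _) (Or.inr rfl)
  exact ((t0.trans t1).mono_right Set.subset_union_right).mono_size (by omega)

/-- **`d + n < x + n` below position `W+1`**: the comparator `T2` linked with `T1`.
[cite: CookReckhow1979, §2] -/
theorem linkT2 (hG : RulesOK G) (av : AuxViews W o a K Γ)
    (h1 : {χ | χ ∈ Sub.subAddLines (S W o) (E W o a) K (W + 1)} ⊆ Γ)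
    (h2 : {χ | χ ∈ Adder.commLines (A W o) (YX W o a) K W} ⊆ Γ)
    (h3 : ctx K (neg (var ((T1 W o a).ge (W + 1) (W + 1)))) ∈ Γ)
    (h4 : ctxSet K (eqW (NX W o a).wire (XN W o a).wire (2 * W + 1)) ⊆ Γ)
    (h5 : ctx K (eqv ((XN W o a).s W) ((XN W o a).c W)) ∈ Γ) :
    G.Yields Γ {ctx K (neg (var ((T2 W o a).ge (W + 2) (W + 1))))} ((6 * W + 10) * (K.size + 10)) := by
  -- t6a: `E.s = s = extOut (y + x)`
  have t6a : G.Yields Γ (ctxSet K (eqW (E W o a).s (Adder.extOut (YX W o a) W) (W + 1))) ((W + 1) * (K.size + 10)) := by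
    refine Yields.eqW_trans hG.logic (b := Adder.extOut (A W o) W) (holds_eqW_iff.2 fun i hi => ?_) (holds_eqW_iff.2 fun i hi => ?_)
    · exact h1 (Sub.sum_mem_subAddLines (S := S W o) (E := E W o a) (K := K) hi)
    · refine h2 ?_
      show ctx K (eqv (Adder.extOut (A W o) W i) (Adder.extOut (YX W o a) W i)) ∈ Adder.commLines (A W o) (YX W o a) K W
      rcases Nat.lt_succ_iff_lt_or_eq.1 hi with hi' | hi'
      · rw [Adder.extOut_lt _ hi', Adder.extOut_lt _ hi']; exact Adder.mem_commLines (by omega)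
      · rw [hi', Adder.extOut_top, Adder.extOut_top]; exact Adder.mem_commLines (by omega)
  set A1 := ctxSet K (eqW (E W o a).s (Adder.extOut (YX W o a) W) (W + 1)) with hA1
  -- t6b: the wires of `x + n` and `n + x`, reversed
  have t6b : G.Yields (Γ ∪ A1) (ctxSet K (eqW (XN W o a).wire (NX W o a).wire (2 * W + 1))) ((2 * W + 1) * (K.size + 10)) :=
    Yields.eqW_symm hG.logic (holds_eqW_iff.2 fun k hk => Or.inl (h4 (mem_ctxSet (mem_eqW hk))))
  set A2 := A1 ∪ ctxSet K (eqW (XN W o a).wire (NX W o a).wire (2 * W + 1)) with hA2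
  -- t6c: the top sum bit of `x + n` is the carry-out of `n + x`
  have t6c : G.Yields (Γ ∪ A2) {ctx K (eqv ((XN W o a).s W) ((NX W o a).c W))} (K.size + 10) := by
    have h := Yields.single (Logic.infer hG.logic 6 (by decide) (S := Γ ∪ A2)
      (FregeSystem.sub [K, var ((XN W o a).s W), var ((XN W o a).c W), var ((NX W o a).c W)])
      (θ := ctx K (eqv ((XN W o a).s W) ((NX W o a).c W))) rfl
      (FregeSystem.prems_cons (Or.inl h5)
        (FregeSystem.prems_cons (Or.inr (Or.inr (mem_ctxSet (mem_eqW (a := (XN W o a).wire) (show 2 * W < 2 * W + 1 by omega)))))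
          FregeSystem.prems_nil)))
    exact h.mono_size (by simp [ctx, eqv, size, FregeSystem.size_biimp])
  set A3 := A2 ∪ {ctx K (eqv ((XN W o a).s W) ((NX W o a).c W))} with hA3
  -- t6d: link `T2` (on `W+2` bits) with `T1` below position `W+1`
  have t6d : G.Yields (Γ ∪ A3) (ctxSet K (linkLines (T2 W o a) (T1 W o a) (W + 2) (W + 1) (W + 1))) ((3 * (W + 1) + 1) * (K.size + 10)) := by
    refine linkLow hG (T2 W o a) (T1 W o a) (av.t2.mono Set.subset_union_left) (av.t1.mono Set.subset_union_left) (by omega) le_rfl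
      (fun i hi => ?_) fun i hi => ?_
    · show ctx K (eqv (Adder.extOut (E W o a) (W + 1) i) (Adder.extOut (YX W o a) W i)) ∈ Γ ∪ A3
      rw [Adder.extOut_lt _ hi]
      exact Or.inr (Or.inl (Or.inl (mem_ctxSet (mem_eqW (a := (E W o a).s) hi))))
    · show ctx K (eqv (Adder.extOut (XN W o a) (W + 1) i) (Adder.extOut (NX W o a) W i)) ∈ Γ ∪ A3
      rw [Adder.extOut_lt _ hi]
      rcases Nat.lt_succ_iff_lt_or_eq.1 hi with hi' | hi'
      · rw [Adder.extOut_lt _ hi']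
        exact Or.inr (Or.inl (Or.inr (mem_ctxSet (mem_eqW (a := (XN W o a).wire) (show 2 * i + 1 < 2 * W + 1 by omega)))))
      · rw [hi', Adder.extOut_top]; exact Or.inr (Or.inr rfl)
  set A4 := A3 ∪ ctxSet K (linkLines (T2 W o a) (T1 W o a) (W + 2) (W + 1) (W + 1)) with hA4
  -- t6e: transport `¬ge(T1)`
  have t6e : G.Yields (Γ ∪ A4) {ctx K (neg (var ((T2 W o a).ge (W + 2) (W + 1))))} (2 * (K.size + 10)) :=
    negTransport hG (Or.inl h3) (Or.inr (Or.inr (mem_ctxSet (ge_mem_linkLines _ _ _ _ _))))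
  have h := (((t6a.trans t6b).trans t6c).trans t6d).trans t6e
  exact (h.mono_right Set.subset_union_right).mono_size (by nlinarith)

/-- **`x < n` on `W+1` bits** (comparator `CXN`), from the certificate of `x`. [cite: CookReckhow1979, §2] -/
theorem cxnLt (hG : RulesOK G) (av : AuxViews W o a K Γ) (hx : LtN W K Γ o.inp (nv W o)) :
    G.Yields Γ {ctx K (neg (var ((CXN W o a).ge (W + 1) (W + 1))))} ((6 * W + 6) * (K.size + 10)) := by
  have t0 := (Yields.eqW_refl hG.adder K o.inp (3 * W) (Γ := Γ)).union (Yields.lit_of_cstDef hG.logic av.bot)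
  set A0 : Set (PropForm ℕ) := ctxSet K (eqW o.inp o.inp (3 * W)) ∪ {ctx K (lit (fa a) false)} with hA0
  have t1 : G.Yields (Γ ∪ A0) {ctx K (neg (var ((CXN W o a).ge (W + 1) W)))} ((3 * W + 2) * (K.size + 10)) := by
    refine (hx.mono Set.subset_union_left).transport hG (CXN W o a) (av.cxn.mono Set.subset_union_left) (Nat.le_succ W)
      (fun i hi => ?_) fun i hi => ?_
    · show ctx K (eqv (o.inp i) (Adder.zext o.inp (fa a) W i)) ∈ Γ ∪ A0
      rw [Adder.zext_lt _ _ hi]; exact Or.inr (Or.inl (mem_ctxSet (mem_eqW (show i < 3 * W by omega))))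
    · show ctx K (eqv (nv W o i) (Adder.zext (nv W o) (fa a) W i)) ∈ Γ ∪ A0
      rw [Adder.zext_lt _ _ hi]; exact Or.inr (Or.inl (mem_ctxSet (mem_eqW (a := o.inp) (show 2 * W + i < 3 * W by omega))))
  set A1 := A0 ∪ {ctx K (neg (var ((CXN W o a).ge (W + 1) W)))} with hA1
  have t2 : G.Yields (Γ ∪ A1) {ctx K (eqv ((CXN W o a).ge (W + 1) (W + 1)) ((CXN W o a).ge (W + 1) W))} (K.size + 10) := by
    refine topEqv hG (CXN W o a) (av.cxn.mono Set.subset_union_left) ?_ ?_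
    · show ctx K (neg (var (Adder.zext o.inp (fa a) W W))) ∈ Γ ∪ A1
      rw [Adder.zext_top]; exact Or.inr (Or.inl (Or.inr rfl))
    · show ctx K (neg (var (Adder.zext (nv W o) (fa a) W W))) ∈ Γ ∪ A1
      rw [Adder.zext_top]; exact Or.inr (Or.inl (Or.inr rfl))
  set A2 := A1 ∪ {ctx K (eqv ((CXN W o a).ge (W + 1) (W + 1)) ((CXN W o a).ge (W + 1) W))} with hA2
  have t3 : G.Yields (Γ ∪ A2) {ctx K (neg (var ((CXN W o a).ge (W + 1) (W + 1))))} (2 * (K.size + 10)) :=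
    negTransport hG (Or.inr (Or.inl (Or.inr rfl))) (Or.inr (Or.inr rfl))
  have h := ((t0.trans t1).trans t2).trans t3
  exact (h.mono_right Set.subset_union_right).mono_size (by nlinarith)

/-! ### The law: carried facts and case contexts -/

/-- The facts carried into the case `G`. [folklore] -/
def selFacts (W : ℕ) (o a : Occ) : List (PropForm ℕ) :=
  [biimp (var ((E W o a).c (W + 1))) (neg (var (sel W o))), neg (var ((T2 W o a).ge (W + 2) (W + 1))),
    neg (var ((XN W o a).c (W + 1))), neg (var ((CXN W o a).ge (W + 1) (W + 1))), neg (var (fa a))] ++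
    eqW (nv W o) (nv W o) W

/-- The facts carried into the case `¬G`. [folklore] -/
def notSelFacts (W : ℕ) (o : Occ) : List (PropForm ℕ) := [neg (var (f W o))] ++ eqW (nv W o) (nv W o) W

/-- Sizes of the carried facts. [folklore] -/
theorem size_of_mem_selFacts {L : PropForm ℕ} (h : L ∈ selFacts W o a) : L.size ≤ 11 := by
  rcases List.mem_append.1 h with h | h
  · simp only [List.mem_cons, List.not_mem_nil, or_false] at h
    rcases h with h | h | h | h | h <;> subst h <;> simp [FregeSystem.size_biimp, size]
  · obtain ⟨i, -, rfl⟩ := List.mem_map.1 h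
    simp [size_eqv]

/-- Sizes of the carried facts. [folklore] -/
theorem size_of_mem_notSelFacts {L : PropForm ℕ} (h : L ∈ notSelFacts W o) : L.size ≤ 9 := by
  rcases List.mem_append.1 h with h | h
  · simp only [List.mem_cons, List.not_mem_nil, or_false] at h
    subst h; simp [size]
  · obtain ⟨i, -, rfl⟩ := List.mem_map.1 h
    simp [size_eqv]

/-- Length of the carried facts. [folklore] -/
@[simp] theorem length_selFacts : (selFacts W o a).length = W + 5 := by simp [selFacts, eqW]

/-- Length of the carried facts. [folklore] -/
@[simp] theorem length_notSelFacts : (notSelFacts W o).length = W + 1 := by simp [notSelFacts, eqW]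

/-- The context of the case `G`. [folklore] -/
def selCtx (W : ℕ) (K : PropForm ℕ) (o : Occ) : PropForm ℕ := disj K (neg (var (sel W o)))

/-- The context of the case `¬G`. [folklore] -/
def notSelCtx (W : ℕ) (K : PropForm ℕ) (o : Occ) : PropForm ℕ := disj K (var (sel W o))

/-- Size of the case context. [folklore] -/
@[simp] theorem size_selCtx : (selCtx W K o).size = K.size + 3 := by simp [selCtx, size]

/-- Size of the case context. [folklore] -/
@[simp] theorem size_notSelCtx : (notSelCtx W K o).size = K.size + 2 := by simp [notSelCtx, size]

end DomAux

/-! ### The law -/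

section Law

open DomAux

variable {G : FregeSystem} {K : PropForm ℕ} {Γ : Set (PropForm ℕ)} {W : ℕ} {o a : Occ}

/-- **Domain closure of modular addition inside Frege**: for an available occurrence of `x ⊕ₙ y`
with `x < n` and `y < n` certified, and an available correctly wired occurrence of the auxiliary
template, the domain wire is provably false, i.e. `x ⊕ₙ y < n` is certified. Polynomial size:
`≤ (90W + 160)(|K| + 63)`. [cite: CookReckhow1979, §2] [cite: Krajicek1995, §9.2] -/
theorem domOp (hG : RulesOK G) (ho : o.Avail (addModT W) (3 * W) K Γ) (haa : a.Avail (domAuxT W) (4 * W + 1) K Γ)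
    (hw : Wired W o a) (hx : LtN W K Γ o.inp (nv W o)) (hy : LtN W K Γ (fun i => o.inp (W + i)) (nv W o)) :
    G.Yields Γ {ctx K (neg (var (domv W o)))} ((90 * W + 160) * (K.size + 63)) := by
  have v := avail ho
  have av := auxAvail haa hw
  have hΓ : ∀ {X : Set (PropForm ℕ)}, Γ ⊆ Γ ∪ X := fun {X} => Set.subset_union_left
  -- the case-free preparations
  have p1 := eqBot hG v av
  set A1 : Set (PropForm ℕ) := {ctx K (eqv (fa a) (f W o))} with hA1
  have p2 := subAdd hG (v.mono hΓ) (av.mono hΓ) (Or.inr rfl : ctx K (eqv (fa a) (f W o)) ∈ Γ ∪ A1)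
  set A2 := A1 ∪ {χ | χ ∈ Sub.subAddLines (S W o) (E W o a) K (W + 1)} with hA2
  have p3 := commAYX hG (v.mono (hΓ (X := A2))) (av.mono hΓ)
  set A3 := A2 ∪ {χ | χ ∈ Adder.commLines (A W o) (YX W o a) K W} with hA3
  have p4 := mono1 hG (av.mono (hΓ (X := A3))) (hy.mono hΓ)
  set A4 := A3 ∪ {ctx K (neg (var ((T1 W o a).ge (W + 1) (W + 1))))} with hA4
  have p5 := commNX hG (av.mono (hΓ (X := A4)))
  set A5 := A4 ∪ ctxSet K (eqW (NX W o a).wire (XN W o a).wire (2 * W + 1)) with hA5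
  have p6 := topXN hG (av.mono (hΓ (X := A5)))
  set A6 := A5 ∪ ({ctx K (eqv ((XN W o a).s W) ((XN W o a).c W))} ∪ {ctx K (neg (var ((XN W o a).c (W + 1))))}) with hA6
  have p7 := linkT2 hG (av.mono (hΓ (X := A6))) (fun θ hθ => Or.inr (Or.inl (Or.inl (Or.inl (Or.inl (Or.inr hθ))))))
    (fun θ hθ => Or.inr (Or.inl (Or.inl (Or.inl (Or.inr hθ))))) (Or.inr (Or.inl (Or.inl (Or.inr rfl))))
    (fun θ hθ => Or.inr (Or.inl (Or.inr hθ))) (Or.inr (Or.inr (Or.inl rfl)))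
  set A7 := A6 ∪ {ctx K (neg (var ((T2 W o a).ge (W + 2) (W + 1))))} with hA7
  have p8 := cxnLt hG (av.mono (hΓ (X := A7))) (hx.mono hΓ)
  set A8 := A7 ∪ {ctx K (neg (var ((CXN W o a).ge (W + 1) (W + 1))))} with hA8
  have p9 := ((Yields.eqW_refl hG.adder K (nv W o) W (Γ := Γ ∪ A8)).union (Yields.lit_of_cstDef hG.logic (hΓ v.bot))).union
    (Yields.lit_of_cstDef hG.logic (hΓ av.bot))
  set A9 := A8 ∪ ((ctxSet K (eqW (nv W o) (nv W o) W) ∪ {ctx K (lit (f W o) false)}) ∪ {ctx K (lit (fa a) false)}) with hA9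
  have pAll := (((((((p1.trans p2).trans p3).trans p4).trans p5).trans p6).trans p7).trans p8).trans p9
  -- memberships of the carried facts in `Γ ∪ A9`
  have mEc : ctx K (biimp (var ((E W o a).c (W + 1))) (neg (var (sel W o)))) ∈ Γ ∪ A9 :=
    Or.inr (Or.inl (Or.inl (Or.inl (Or.inl (Or.inl (Or.inl (Or.inl (Or.inr
      (Sub.carry_mem_subAddLines (S := S W o) (E := E W o a) (K := K) (w := W + 1) le_rfl)))))))))
  have mT2 : ctx K (neg (var ((T2 W o a).ge (W + 2) (W + 1)))) ∈ Γ ∪ A9 := Or.inr (Or.inl (Or.inl (Or.inr rfl)))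
  have mXN : ctx K (neg (var ((XN W o a).c (W + 1)))) ∈ Γ ∪ A9 := Or.inr (Or.inl (Or.inl (Or.inl (Or.inr (Or.inr rfl)))))
  have mCXN : ctx K (neg (var ((CXN W o a).ge (W + 1) (W + 1)))) ∈ Γ ∪ A9 := Or.inr (Or.inl (Or.inr rfl))
  have mfa : ctx K (neg (var (fa a))) ∈ Γ ∪ A9 := Or.inr (Or.inr (Or.inr rfl))
  have mf : ctx K (neg (var (f W o))) ∈ Γ ∪ A9 := Or.inr (Or.inr (Or.inl (Or.inr rfl)))
  have mn : ∀ i < W, ctx K (eqv (nv W o i) (nv W o i)) ∈ Γ ∪ A9 := fun i hi => Or.inr (Or.inr (Or.inl (Or.inl (mem_ctxSet (mem_eqW hi)))))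
  have hoD : (o.inst (3 * W)).DefsAvail (addModT W) K (Γ ∪ A9) := Inst.DefsAvail.mono ho hΓ
  have haD : (a.inst (4 * W + 1)).DefsAvail (domAuxT W) K (Γ ∪ A9) := Inst.DefsAvail.mono haa hΓ
  -- case `G`: context `K ∨ ¬G`
  have hsel : Holds K (Γ ∪ A9) (selFacts W o a) := by
    intro L hL
    rcases List.mem_append.1 hL with hL | hL
    · simp only [List.mem_cons, List.not_mem_nil, or_false] at hL
      rcases hL with rfl | rfl | rfl | rfl | rfl
      exacts [mEc, mT2, mXN, mCXN, mfa]
    · obtain ⟨i, hi, rfl⟩ := List.mem_map.1 hL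
      exact mn i (List.mem_range.1 hi)
  have b₁ : G.Yields (Γ ∪ A9) {ctx (selCtx W K o) (neg (var (domv W o)))}
      ((9 * W + 7) * (K.size + 2 + 59) + (23 * W + 32) * (K.size + 2 + 59) + (W + 5) * (K.size + 2 + 11 + 2) +
        (K.size + 2 * 1 + 3) + (9 * W + 40) * (K.size + 3 + 60)) := by
    have w1 : G.Yields (Γ ∪ A9) (ctxSet (selCtx W K o) ((o.inst (3 * W)).defBodies (addModT W))) ((9 * W + 7) * (K.size + 2 + 59)) := by
      have h := hoD.weaken hG.logic (neg (var (sel W o))); rw [length_addModT] at h; exact h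
    have w2 : G.Yields (Γ ∪ A9) (ctxSet (selCtx W K o) ((a.inst (4 * W + 1)).defBodies (domAuxT W))) ((23 * W + 32) * (K.size + 2 + 59)) := by
      have h := haD.weaken hG.logic (neg (var (sel W o))); rw [length_domAuxT] at h; exact h
    have w3 : G.Yields (Γ ∪ A9) (ctxSet (selCtx W K o) (selFacts W o a)) ((W + 5) * (K.size + 2 + 11 + 2)) := by
      have h := Yields.weaken hG.logic hsel (neg (var (sel W o))) fun L hL => size_of_mem_selFacts hL
      rw [length_selFacts] at h; exact h
    have w4 : G.Yields (Γ ∪ A9) {ctx (selCtx W K o) (var (sel W o))} (K.size + 2 * 1 + 3) :=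
      Yields.caseHypT hG.logic K (var (sel W o))
    have w := ((w1.union w2).union w3).union w4
    set B : Set (PropForm ℕ) := ((ctxSet (selCtx W K o) ((o.inst (3 * W)).defBodies (addModT W)) ∪
      ctxSet (selCtx W K o) ((a.inst (4 * W + 1)).defBodies (domAuxT W))) ∪ ctxSet (selCtx W K o) (selFacts W o a)) ∪
      {ctx (selCtx W K o) (var (sel W o))} with hB
    have hoD₁ : o.Avail (addModT W) (3 * W) (selCtx W K o) (Γ ∪ A9 ∪ B) :=
      Inst.defsAvail_of_ctxSet_subset fun θ hθ => Or.inr (Or.inl (Or.inl (Or.inl hθ)))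
    have haD₁ : a.Avail (domAuxT W) (4 * W + 1) (selCtx W K o) (Γ ∪ A9 ∪ B) :=
      Inst.defsAvail_of_ctxSet_subset fun θ hθ => Or.inr (Or.inl (Or.inl (Or.inr hθ)))
    have v₁ : Views W o (selCtx W K o) (Γ ∪ A9 ∪ B) := avail hoD₁
    have av₁ : AuxViews W o a (selCtx W K o) (Γ ∪ A9 ∪ B) := auxAvail haD₁ hw
    have hF : ∀ L ∈ selFacts W o a, ctx (selCtx W K o) L ∈ Γ ∪ A9 ∪ B := fun L hL => Or.inr (Or.inl (Or.inr (mem_ctxSet hL)))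
    have m1 : biimp (var ((E W o a).c (W + 1))) (neg (var (sel W o))) ∈ selFacts W o a := List.mem_append_left _ (by simp)
    have m2 : neg (var ((T2 W o a).ge (W + 2) (W + 1))) ∈ selFacts W o a := List.mem_append_left _ (by simp)
    have m3 : neg (var ((XN W o a).c (W + 1))) ∈ selFacts W o a := List.mem_append_left _ (by simp)
    have m4 : neg (var ((CXN W o a).ge (W + 1) (W + 1))) ∈ selFacts W o a := List.mem_append_left _ (by simp)
    have m5 : neg (var (fa a)) ∈ selFacts W o a := List.mem_append_left _ (by simp)
    have c := caseSel hG v₁ av₁ (Or.inr (Or.inr rfl)) (hF _ m1) (hF _ m2) (hF _ m3) (hF _ m4) (hF _ m5)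
      (holds_eqW_iff.2 fun i hi => hF _ (List.mem_append_right _ (mem_eqW hi)))
    rw [size_selCtx] at c
    exact (w.trans c).mono_right Set.subset_union_right
  -- case `¬G`: context `K ∨ G`
  have hnsel : Holds K (Γ ∪ A9) (notSelFacts W o) := by
    intro L hL
    rcases List.mem_append.1 hL with hL | hL
    · rw [List.mem_singleton.1 hL]; exact mf
    · obtain ⟨i, hi, rfl⟩ := List.mem_map.1 hL
      exact mn i (List.mem_range.1 hi)
  have b₂ : G.Yields (Γ ∪ A9) {ctx (notSelCtx W K o) (neg (var (domv W o)))}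
      ((9 * W + 7) * (K.size + 1 + 59) + (W + 1) * (K.size + 1 + 9 + 2) + (K.size + 2 * 1 + 3) + (4 * W + 5) * (K.size + 2 + 10)) := by
    have w1 : G.Yields (Γ ∪ A9) (ctxSet (notSelCtx W K o) ((o.inst (3 * W)).defBodies (addModT W))) ((9 * W + 7) * (K.size + 1 + 59)) := by
      have h := hoD.weaken hG.logic (var (sel W o)); rw [length_addModT] at h; exact h
    have w3 : G.Yields (Γ ∪ A9) (ctxSet (notSelCtx W K o) (notSelFacts W o)) ((W + 1) * (K.size + 1 + 9 + 2)) := by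
      have h := Yields.weaken hG.logic hnsel (var (sel W o)) fun L hL => size_of_mem_notSelFacts hL
      rw [length_notSelFacts] at h; exact h
    have w4 : G.Yields (Γ ∪ A9) {ctx (notSelCtx W K o) (neg (var (sel W o)))} (K.size + 2 * 1 + 3) :=
      Yields.caseHypF hG.logic K (var (sel W o))
    have w := (w1.union w3).union w4
    set B : Set (PropForm ℕ) := (ctxSet (notSelCtx W K o) ((o.inst (3 * W)).defBodies (addModT W)) ∪
      ctxSet (notSelCtx W K o) (notSelFacts W o)) ∪ {ctx (notSelCtx W K o) (neg (var (sel W o)))} with hB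
    have hoD₂ : o.Avail (addModT W) (3 * W) (notSelCtx W K o) (Γ ∪ A9 ∪ B) :=
      Inst.defsAvail_of_ctxSet_subset fun θ hθ => Or.inr (Or.inl (Or.inl hθ))
    have v₂ : Views W o (notSelCtx W K o) (Γ ∪ A9 ∪ B) := avail hoD₂
    have hF : ∀ L ∈ notSelFacts W o, ctx (notSelCtx W K o) L ∈ Γ ∪ A9 ∪ B := fun L hL => Or.inr (Or.inl (Or.inr (mem_ctxSet hL)))
    have c := caseNotSel hG v₂ (Or.inr (Or.inr rfl)) (hF _ (List.mem_append_left _ (List.mem_singleton_self _)))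
      (holds_eqW_iff.2 fun i hi => hF _ (List.mem_append_right _ (mem_eqW hi)))
    rw [size_notSelCtx] at c
    exact (w.trans c).mono_right Set.subset_union_right
  -- merging the cases
  have hcases := Yields.cases hG.logic (K := K) (A := var (sel W o)) (Ls := [neg (var (domv W o))]) (c := 2)
    (b₁.mono_right fun θ hθ => by obtain ⟨L, hL, rfl⟩ := hθ; rw [List.mem_singleton.1 hL]; rfl)
    (b₂.mono_right fun θ hθ => by obtain ⟨L, hL, rfl⟩ := hθ; rw [List.mem_singleton.1 hL]; rfl)
    (fun L hL => by rw [List.mem_singleton.1 hL]; simp [size])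
  have h := pAll.trans (hcases.mono_right (fun θ hθ => by rw [Set.mem_singleton_iff.1 hθ]; exact mem_ctxSet (List.mem_singleton_self _)) :
    G.Yields (Γ ∪ A9) {ctx K (neg (var (domv W o)))} _)
  refine (h.mono_right Set.subset_union_right).mono_size ?_
  simp only [List.length_singleton]
  nlinarith [Nat.zero_le W, Nat.zero_le K.size]

end Law

end ModAdd

end Literature.Computability.MetaComplexity
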